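import Summits.Schanuel.Schanuel.Theorems.ZilberEacSlowRegimeKronecker
import Summits.Schanuel.Schanuel.Theorems.ZilberEacRationalAsymptote
import HarnessLib

/-!
# Arbitrary base branches, LXXIX: RATIONAL asymptotic directions with a SLOW sheared coordinate —
# transport + (growth or Kronecker); the curve `(x₁ − x₀)² = i·x₀`

HONEST FRAMING.  Cell `pub-schanuel` (Zilber's Exponential-Algebraic Closedness, case ladder;
host summit Schanuel), seat 2, gen 32.  Along a place with equal pole orders and a RATIONAL real
direction `x₁ ~ (p/q)x₀` the sheared coordinate `x₁' = qx₁ − px₀` is either bounded (a rational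
asymptote: file LXVIII(b)) or unbounded of lower order, `x₁' = γ(s)s^{-M'}` with `1 ≤ M' < k`.
File LXIX transported the growth computation to `Φ_U(S)` when `Re(γ(0)z^{M'}) ≠ 0` for some
`z^k = 2πi`.  With file LXXVIII's slow-regime engine the same transport now also covers the bad
directions with an IRRATIONAL top phase:
**`unprojectedDense_transportedSlow`** — `U ∈ GL₂(ℤ)`, `U₁₀x₀ + U₁₁x₁ = γ(s)s^{-M'}` (`M' < k`),
`U₀₀x₀ + U₀₁x₁ = δ(s)s^{-k}` with `δ(0) ≠ 0`, any fibre value `ψ(s)s^L`, and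
`Re(γ(0)z^{M'}) ≠ 0 ∨ Im(γ(0)z^{M'})/2π ∉ ℚ` ⟹ dense; curve level:
**`unprojectedDensityQuestion_planeCurve_polyFibre_transportedSlow`**; example
**`unprojectedDensityQuestion_shearedParabolaI_polyFibre`**: `(x₁ − x₀)² = i·x₀` — direction
`(1 : 1)`, `x₁ − x₀ = e^{iπ/4}s^{-1}` with `x₀ = s^{-2}`: `(e^{iπ/4}z)² = i·2πi = −2π`, a BAD
direction with top phase `±1/√(2π) ∉ ℚ` (`π ∉ ℚ`): every polynomial fibre case ∧ dense.  So for
equal-order places only the RESONANT sheared phases (`γ(0)z^{M'} ∈ 2πiℚ`) remain — impossible for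
curves over `ℚ̄` (Lindemann; to be formalised).  Decided instances of an OPEN question
(Mantova–Masser, PLMS 2024 §1 p. 5); EC(3,2) OPEN; NOT Schanuel's conjecture (neither used nor
implied); EAC ⇏ SC.
-/

noncomputable section

open Filter Topology Set Complex Polynomial
open Literature.NumberTheory.Transcendental Literature.ModelTheory.Zilber
open Literature.ModelTheory.ExponentialFields

set_option linter.dupNamespace false

namespace Summit.Schanuel.Schanuel.Theorems

/-! ## Part A. The engine: transport + slow regime -/

section TransportedSlow

/-- **Transport + slow regime.**  `S` irreducible closed of dimension `≤ 2` containing the germ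
`(s^{-k}, X₁(s), ψ(s)s^L, e^{X₁(s)})` (`ψ(0) ≠ 0`); `U ∈ GL₂(ℤ)` (inverse `V`) with
`U₁₀s^{-k} + U₁₁X₁(s) = γ(s)s^{-M'}` (`1 ≤ M' < k`, `γ` analytic) and
`U₀₀s^{-k} + U₀₁X₁(s) = δ(s)s^{-k}` (`δ` analytic, `δ(0) ≠ 0`); top phase of the sheared coordinate
non-resonant: `Re(γ(0)z^{M'}) ≠ 0` or `Im(γ(0)z^{M'})/2π ∉ ℚ` for some `z^k = 2πi`.  Then
`I(S ∩ Γ_exp) = I(S)`: file LXXVIII's engine on the transported points in `Φ_U(S)`, and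
`unprojectedDense_latticeClosure_iff`. [cite: MantovaMasser2023, §1 Further remarks, p. 5 (the
question, open in general)] (new) -/
theorem unprojectedDense_transportedSlow {S : Set (Fin 2 ⊕ Fin 2 → ℂ)} (hS : IsIrreducibleClosed ℂ S)
    (hdim : zariskiDim ℂ S ≤ (2 : ℕ)) (U V : Matrix (Fin 2) (Fin 2) ℤ) (hUV : U * V = 1) (hVU : V * U = 1)
    {k M' : ℕ} (hM' : 1 ≤ M') (hM'k : M' < k) {X₁ γ δ : ℂ → ℂ} (hγan : AnalyticAt ℂ γ 0)
    (hδan : AnalyticAt ℂ δ 0) (hδ0 : δ 0 ≠ 0)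
    (hγ : ∀ᶠ s in 𝓝[≠] (0 : ℂ), (U 1 0 : ℂ) * (s ^ k)⁻¹ + (U 1 1 : ℂ) * X₁ s = γ s * (s ^ M')⁻¹)
    (hδ : ∀ᶠ s in 𝓝[≠] (0 : ℂ), (U 0 0 : ℂ) * (s ^ k)⁻¹ + (U 0 1 : ℂ) * X₁ s = δ s * (s ^ k)⁻¹)
    (hdir : ∃ z : ℂ, z ^ k = 2 * Real.pi * I ∧
      ((γ 0 * z ^ M').re ≠ 0 ∨ Irrational ((γ 0 * z ^ M').im / (2 * Real.pi))))
    (L : ℤ) {ψ : ℂ → ℂ} (hψan : AnalyticAt ℂ ψ 0) (hψ0 : ψ 0 ≠ 0)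
    (hgerm : ∀ᶠ s in 𝓝[≠] (0 : ℂ),
      (Sum.elim ![(s ^ k)⁻¹, X₁ s] ![ψ s * s ^ L, Complex.exp (X₁ s)] : Fin 2 ⊕ Fin 2 → ℂ) ∈ S) :
    UnprojectedDense S := by
  classical
  have hk : 1 ≤ k := by omega
  have hk0 : k ≠ 0 := by omega
  obtain ⟨z, hz, hzdir⟩ := hdir
  -- exponential points along the germ
  obtain ⟨N₀, u, s, w, W, hN₀, hu, hu0, hwW, hudef, hsu, hs0, hs, hexp⟩ :=
    exists_poleFibre_expPoints hk L hψan hψ0 hz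
  have hsW : Tendsto s atTop (𝓝[≠] (0 : ℂ)) :=
    tendsto_nhdsWithin_iff.2 ⟨hs, Eventually.of_forall hs0⟩
  obtain ⟨J₀, hJ₀⟩ := Filter.eventually_atTop.1 (hsW.eventually (hgerm.and (hγ.and hδ)))
  set p : ℕ → Fin 2 ⊕ Fin 2 → ℂ := fun m =>
    Sum.elim ![(s (J₀ + m) ^ k)⁻¹, X₁ (s (J₀ + m))]
      ![ψ (s (J₀ + m)) * s (J₀ + m) ^ L, Complex.exp (X₁ (s (J₀ + m)))] with hp
  have hpS : ∀ m, p m ∈ S := fun m => (hJ₀ (J₀ + m) (Nat.le_add_right _ _)).1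
  have hpc : ∀ m, (U 1 0 : ℂ) * (s (J₀ + m) ^ k)⁻¹ + (U 1 1 : ℂ) * X₁ (s (J₀ + m)) =
      γ (s (J₀ + m)) * (s (J₀ + m) ^ M')⁻¹ := fun m => (hJ₀ (J₀ + m) (Nat.le_add_right _ _)).2.1
  have hpd : ∀ m, (U 0 0 : ℂ) * (s (J₀ + m) ^ k)⁻¹ + (U 0 1 : ℂ) * X₁ (s (J₀ + m)) =
      δ (s (J₀ + m)) * (s (J₀ + m) ^ k)⁻¹ := fun m => (hJ₀ (J₀ + m) (Nat.le_add_right _ _)).2.2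
  have hpΓ : ∀ m, p m ∈ expGraph ℂ 2 := by
    intro m
    rw [mem_expGraph_iff]
    intro i
    rw [Literature.ModelTheory.ExponentialFields.ExponentialRing.complex_exp_eq]
    fin_cases i
    · simp [hp, hexp (J₀ + m)]
    · simp [hp]
  have hpT : ∀ m, p m ∈ torusLocus ℂ 2 := fun m => expGraph_subset_torusLocus (hpΓ m)
  have hne : (S ∩ torusLocus ℂ 2).Nonempty := ⟨p 0, hpS 0, hpT 0⟩
  -- the transported surface and points
  set S' : Set (Fin 2 ⊕ Fin 2 → ℂ) := latticeClosure U S with hS'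
  have hS'irr : IsIrreducibleClosed ℂ S' := isIrreducibleClosed_latticeClosure U hS hne
  have hS'dim : zariskiDim ℂ S' ≤ (2 : ℕ) := by
    rw [hS', zariskiDim_latticeClosure hUV hVU hS hne]; exact hdim
  set p' : ℕ → Fin 2 ⊕ Fin 2 → ℂ := fun m => latticeChange U (p m) with hp'
  have hp'S : ∀ m, p' m ∈ S' := fun m =>
    latticeImage_subset_latticeClosure U S ⟨p m, ⟨hpS m, hpT m⟩, rfl⟩
  have hp'Γ : ∀ m, p' m ∈ expGraph ℂ 2 := fun m => latticeChange_mem_expGraph (hpΓ m)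
  have hp'x₁ : ∀ m, p' m (Sum.inl 1) = γ (s (J₀ + m)) * (s (J₀ + m) ^ M')⁻¹ := by
    intro m
    change latticeChange U (p m) (Sum.inl 1) = _
    rw [latticeChange_inl, intLinMap_two]
    simp only [projAdd, hp, Sum.elim_inl, Matrix.cons_val_zero, Matrix.cons_val_one]
    exact hpc m
  have hp'x₀ : ∀ m, p' m (Sum.inl 0) = δ (s (J₀ + m)) * (s (J₀ + m) ^ k)⁻¹ := by
    intro m
    change latticeChange U (p m) (Sum.inl 0) = _
    rw [latticeChange_inl, intLinMap_two]
    simp only [projAdd, hp, Sum.elim_inl, Matrix.cons_val_zero, Matrix.cons_val_one]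
    exact hpd m
  -- `‖x₀'‖ → ∞`
  have hsJ : Tendsto (fun m => s (J₀ + m)) atTop (𝓝 0) :=
    hs.comp ((tendsto_add_atTop_nat J₀).congr fun m => by ring)
  have hx0 : Tendsto (fun m => ‖p' m (Sum.inl 0)‖) atTop atTop := by
    have hδt : Tendsto (fun m => ‖δ (s (J₀ + m))‖) atTop (𝓝 ‖δ 0‖) :=
      (continuous_norm.tendsto _).comp (hδan.continuousAt.tendsto.comp hsJ)
    have hδpos : 0 < ‖δ 0‖ / 2 := by positivity
    have hδlow : ∀ᶠ m in atTop, ‖δ 0‖ / 2 ≤ ‖δ (s (J₀ + m))‖ := by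
      filter_upwards [Metric.tendsto_nhds.1 hδt (‖δ 0‖ / 2) hδpos] with m hm
      rw [Real.dist_eq] at hm
      have := abs_sub_lt_iff.1 hm
      linarith [this.1, this.2]
    have h1 : Tendsto (fun m => ‖s (J₀ + m) ^ k‖⁻¹) atTop atTop := by
      refine Tendsto.inv_tendsto_nhdsGT_zero ?_
      have h2 : Tendsto (fun m => s (J₀ + m) ^ k) atTop (𝓝[≠] 0) :=
        tendsto_nhdsWithin_iff.2 ⟨by have h := hsJ.pow k; rwa [zero_pow hk0] at h,
          Eventually.of_forall fun m => pow_ne_zero _ (hs0 _)⟩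
      exact tendsto_norm_nhdsNE_zero.comp h2
    refine tendsto_atTop_mono' atTop ?_ ((h1.const_mul_atTop hδpos))
    filter_upwards [hδlow] with m hm
    rw [hp'x₀ m, norm_mul, norm_inv]
    exact mul_le_mul_of_nonneg_right hm (by positivity)
  -- file LXXVIII's engine on the transported points (data shifted by `J₀`)
  have hN₀' : 1 ≤ N₀ + J₀ := by omega
  have hidx : ∀ j : ℕ, N₀ + (J₀ + j) = N₀ + J₀ + j := fun j => by ring
  have hdense' : UnprojectedDense S' :=
    unprojectedDense_of_slowCoordinate hS'irr hS'dim hk hz L hN₀' (u := fun j => u (J₀ + j))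
      (s := fun j => s (J₀ + j)) (w := fun j => w (J₀ + j)) (W := W)
      (hu.comp ((tendsto_add_atTop_nat J₀).congr fun j => by ring)) (fun j => hwW _)
      (fun j => by rw [hudef (J₀ + j), hidx]) (fun j => by rw [hsu (J₀ + j), hidx]) (fun j => hs0 _)
      hsJ hp'S hp'Γ hx0 hM' hM'k hγan hp'x₁ hzdir
  exact (unprojectedDense_latticeClosure_iff hUV hVU hS hne).1 hdense'

variable (F : ℂ[X][X])

/-- **Polynomial fibres over a curve with a rational equal-order direction and a slow sheared
coordinate: case ∧ dense.**  `F` irreducible of `x₁`-degree `≥ 2`; a place `x₀ = s^{-k}`,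
`x₁ = X₁(s) = Φ(s)s^{-k}`; `U ∈ GL₂(ℤ)` with `U₁₀x₀ + U₁₁x₁ = γ(s)s^{-M'}`, `1 ≤ M' < k`, and
`U₀₀ + U₀₁Φ(0) ≠ 0`; top phase of `γ` non-resonant; `R` nonzero somewhere on the curve.
[cite: MantovaMasser2023, §1 Further remarks, p. 5 (the question, open in general)] (new) -/
theorem unprojectedDensityQuestion_planeCurve_polyFibre_transportedSlow (hFirr : Irreducible F)
    (hn : 2 ≤ F.natDegree) (U V : Matrix (Fin 2) (Fin 2) ℤ) (hUV : U * V = 1) (hVU : V * U = 1)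
    {k M' : ℕ} (hM' : 1 ≤ M') (hM'k : M' < k) {X₁ Φ γ : ℂ → ℂ} (hΦan : AnalyticAt ℂ Φ 0)
    (hγan : AnalyticAt ℂ γ 0) (hX₁ : ∀ᶠ s in 𝓝[≠] (0 : ℂ), X₁ s = Φ s * (s ^ k)⁻¹)
    (hU0 : (U 0 0 : ℂ) + (U 0 1 : ℂ) * Φ 0 ≠ 0)
    (hγ : ∀ᶠ s in 𝓝[≠] (0 : ℂ), (U 1 0 : ℂ) * (s ^ k)⁻¹ + (U 1 1 : ℂ) * X₁ s = γ s * (s ^ M')⁻¹)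
    (hdir : ∃ z : ℂ, z ^ k = 2 * Real.pi * I ∧
      ((γ 0 * z ^ M').re ≠ 0 ∨ Irrational ((γ 0 * z ^ M').im / (2 * Real.pi))))
    (hplace : ∀ᶠ s in 𝓝[≠] (0 : ℂ), (F.map (Polynomial.evalRingHom (s ^ k)⁻¹)).eval (X₁ s) = 0)
    (R : MvPolynomial (Fin 2) ℂ)
    (hR : ∃ x y : ℂ, (F.map (Polynomial.evalRingHom x)).eval y = 0 ∧ MvPolynomial.eval ![x, y] R ≠ 0) :
    MMCaseDimPiOneFree {w : Fin 2 ⊕ Fin 2 → ℂ |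
        (F.map (Polynomial.evalRingHom (w (Sum.inl 0)))).eval (w (Sum.inl 1)) = 0 ∧
        w (Sum.inr 0) = MvPolynomial.eval ![w (Sum.inl 0), w (Sum.inl 1)] R} ∧
      UnprojectedDense {w : Fin 2 ⊕ Fin 2 → ℂ |
        (F.map (Polynomial.evalRingHom (w (Sum.inl 0)))).eval (w (Sum.inl 1)) = 0 ∧
        w (Sum.inr 0) = MvPolynomial.eval ![w (Sum.inl 0), w (Sum.inl 1)] R} := by
  classical
  have hk : 1 ≤ k := by omega
  refine ⟨mmCase_planeCurve_polyFibre F hFirr hn R hR, ?_⟩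
  obtain ⟨Φr, hΦr⟩ := exists_rowsEquiv
  set A : MvPolynomial (Fin 2) ℂ := Φr.symm F with hA
  have hPQ : ∀ x y : ℂ, MvPolynomial.eval ![x, y] A = (F.map (Polynomial.evalRingHom x)).eval y := by
    intro x y
    rw [hΦr, hA, RingEquiv.apply_symm_apply]
  have hirrA : Irreducible A := (irreducible_rows_iff hPQ).2 hFirr
  have hset : {w : Fin 2 ⊕ Fin 2 → ℂ |
      (F.map (Polynomial.evalRingHom (w (Sum.inl 0)))).eval (w (Sum.inl 1)) = 0 ∧
      w (Sum.inr 0) = MvPolynomial.eval ![w (Sum.inl 0), w (Sum.inl 1)] R} =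
      {w : Fin 2 ⊕ Fin 2 → ℂ | MvPolynomial.eval ![w (Sum.inl 0), w (Sum.inl 1)] A = 0 ∧
        w (Sum.inr 0) = MvPolynomial.eval ![w (Sum.inl 0), w (Sum.inl 1)] R} := by
    ext w
    simp only [Set.mem_setOf_eq, hPQ]
  rw [hset]
  have hS := isIrreducibleClosed_curveGraphFibre R hirrA
  have hdim := zariskiDim_curveGraphFibre R hirrA
  have hndvd : ¬ F ∣ Φr R := by
    refine not_dvd_of_exists_eval_ne_zero F ?_
    obtain ⟨x, y, hxy, hne⟩ := hR
    exact ⟨x, y, hxy, by rw [← hΦr]; exact hne⟩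
  have hplaceΦ : ∀ᶠ s in 𝓝[≠] (0 : ℂ),
      (F.map (Polynomial.evalRingHom (s ^ k)⁻¹)).eval (Φ s * (s ^ k)⁻¹) = 0 := by
    filter_upwards [hplace, hX₁] with s hs hX
    rwa [hX] at hs
  obtain ⟨ψ, L, hψan, hψ0, hf⟩ :=
    exists_rows_place_normalForm F hFirr (by omega) (Φr R) hndvd hk k hΦan hplaceΦ
  have hδ : ∀ᶠ s in 𝓝[≠] (0 : ℂ), (U 0 0 : ℂ) * (s ^ k)⁻¹ + (U 0 1 : ℂ) * X₁ s =
      (fun s => (U 0 0 : ℂ) + (U 0 1 : ℂ) * Φ s) s * (s ^ k)⁻¹ := by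
    filter_upwards [hX₁] with s hX
    rw [hX]
    ring
  refine unprojectedDense_transportedSlow hS (le_of_eq hdim) U V hUV hVU hM' hM'k hγan
    (analyticAt_const.add (analyticAt_const.mul hΦan)) hU0 hγ hδ hdir L hψan hψ0 ?_
  filter_upwards [hplace, hf, hX₁] with s hs hfs hX
  refine ⟨?_, ?_⟩
  · simp only [Sum.elim_inl, Matrix.cons_val_zero, Matrix.cons_val_one]
    rw [hPQ]
    exact hs
  · simp only [Sum.elim_inr, Sum.elim_inl, Matrix.cons_val_zero, Matrix.cons_val_one]
    rw [hΦr, hX, hfs]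

end TransportedSlow

/-! ## Part B. Example: `(x₁ − x₀)² = i·x₀` -/

section ShearedParabolaI

/-- Auxiliary computation for the example (`shearedParabolaI_eval`). [folklore] -/
private theorem shearedParabolaI_eval (x y : ℂ) :
    (((X - Polynomial.C (X : ℂ[X])) ^ 2 - Polynomial.C (Polynomial.C I * X : ℂ[X]) : ℂ[X][X]).map
        (Polynomial.evalRingHom x)).eval y = (y - x) ^ 2 - I * x := by
  simp

/-- Auxiliary computation for the example (`shearedParabolaI_eq`). [folklore] -/
private theorem shearedParabolaI_eq :
    ((X - Polynomial.C (X : ℂ[X])) ^ 2 - Polynomial.C (Polynomial.C I * X : ℂ[X]) : ℂ[X][X]) =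
      X ^ 2 + Polynomial.C (-2 * X : ℂ[X]) * X + Polynomial.C (X ^ 2 - Polynomial.C I * X : ℂ[X]) := by
  simp only [map_neg, map_mul, map_sub, map_pow, map_ofNat]
  ring

/-- Auxiliary computation for the example (`shearedParabolaI_natDegree`). [folklore] -/
private theorem shearedParabolaI_natDegree :
    ((X - Polynomial.C (X : ℂ[X])) ^ 2 - Polynomial.C (Polynomial.C I * X : ℂ[X]) : ℂ[X][X]).natDegree
      = 2 := by
  rw [shearedParabolaI_eq]; compute_degree!

/-- Auxiliary computation for the example (`shearedParabolaI_coeff`). [folklore] -/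
private theorem shearedParabolaI_coeff (j : ℕ) :
    ((X - Polynomial.C (X : ℂ[X])) ^ 2 - Polynomial.C (Polynomial.C I * X : ℂ[X]) : ℂ[X][X]).coeff j =
      if j = 2 then 1 else if j = 1 then -2 * X else if j = 0 then X ^ 2 - Polynomial.C I * X
        else 0 := by
  rw [shearedParabolaI_eq]
  simp only [Polynomial.coeff_add, Polynomial.coeff_X_pow, Polynomial.coeff_C_mul, Polynomial.coeff_X,
    Polynomial.coeff_C]
  rcases j with _ | _ | _ | j <;> simp

/-- Auxiliary computation for the example (`shearedParabolaI_monic`). [folklore] -/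
private theorem shearedParabolaI_monic :
    ((X - Polynomial.C (X : ℂ[X])) ^ 2 - Polynomial.C (Polynomial.C I * X : ℂ[X]) : ℂ[X][X]).Monic := by
  rw [Polynomial.Monic, Polynomial.leadingCoeff, shearedParabolaI_natDegree, shearedParabolaI_coeff]
  simp

/-- `(x₁ − x₀)² − i x₀` is irreducible: a factorisation would make the discriminant `4i·x₀` a square
in `ℂ[x₀]`, of odd degree. [folklore] -/
private theorem shearedParabolaI_irreducible :
    Irreducible ((X - Polynomial.C (X : ℂ[X])) ^ 2 - Polynomial.C (Polynomial.C I * X : ℂ[X]) :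
      ℂ[X][X]) := by
  by_contra hirr
  obtain ⟨c₁, c₂, hmul, hadd⟩ :=
    (shearedParabolaI_monic.not_irreducible_iff_exists_add_mul_eq_coeff shearedParabolaI_natDegree).1 hirr
  rw [shearedParabolaI_coeff] at hmul hadd
  simp only [show ¬ (0 : ℕ) = 2 by norm_num, show ¬ (0 : ℕ) = 1 by norm_num,
    show ¬ (1 : ℕ) = 2 by norm_num, if_false, if_true] at hmul hadd
  have hdisc : (Polynomial.C (4 * I) * X : ℂ[X]) = (c₁ - c₂) ^ 2 := by
    have e : (c₁ - c₂) ^ 2 = (c₁ + c₂) ^ 2 - 4 * (c₁ * c₂) := by ring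
    rw [e, ← hadd, ← hmul, map_mul]
    simp only [map_ofNat]
    ring
  have hdeg := congrArg Polynomial.natDegree hdisc
  rw [Polynomial.natDegree_C_mul_X _ (mul_ne_zero (by norm_num) Complex.I_ne_zero),
    Polynomial.natDegree_pow] at hdeg
  omega

/-- `1/√(2π)`-type numbers are irrational: if `w² = −2π` then `Im w/2π ∉ ℚ` (`π ∉ ℚ`). [folklore] -/
private theorem irrational_im_div_of_sq_eq_neg_two_pi {w : ℂ} (hw : w ^ 2 = -(2 * Real.pi : ℝ)) :
    Irrational (w.im / (2 * Real.pi)) := by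
  have hre : w.re = 0 := by
    have h1 : (w ^ 2).im = 0 := by rw [hw]; simp
    have h2 : (w ^ 2).re = -(2 * Real.pi) := by rw [hw]; simp
    rw [pow_two, Complex.mul_im] at h1
    rw [pow_two, Complex.mul_re] at h2
    have h3 : w.re * w.im = 0 := by linarith
    rcases mul_eq_zero.1 h3 with h | h
    · exact h
    · exfalso
      rw [h, mul_zero, sub_zero] at h2
      nlinarith [Real.pi_pos, mul_self_nonneg w.re]
  have him : w.im ^ 2 = 2 * Real.pi := by
    have h2 : (w ^ 2).re = -(2 * Real.pi) := by rw [hw]; simp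
    rw [pow_two, Complex.mul_re, hre] at h2
    nlinarith
  rintro ⟨r, hr⟩
  have hπ : Irrational Real.pi := irrational_pi
  apply hπ
  have h2π : (2 * Real.pi) ≠ 0 := by positivity
  refine ⟨1 / (2 * r ^ 2), ?_⟩
  have e : (r : ℝ) ^ 2 = 1 / (2 * Real.pi) := by
    rw [hr, div_pow, him]
    field_simp
  push_cast
  rw [e]
  field_simp

/-- **`{(x₁ − x₀)² = i·x₀, y₀ = R(x₀, x₁)}`: case ∧ dense for every `R` nonzero somewhere on the
curve** — rational direction `(1 : 1)`, place `x₀ = s^{-2}`, `x₁ = s^{-2} + e^{iπ/4}s^{-1}`, sheared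
coordinate `x₁ − x₀ = c s^{-1}` (`c² = i`) of order `1 < 2` with `(cz)² = −2π` for `z² = 2πi`: a BAD
direction whose top phase `±1/√(2π)` is irrational. [cite: MantovaMasser2023, §1 Further remarks,
p. 5 (the question, open in general)] (new) -/
theorem unprojectedDensityQuestion_shearedParabolaI_polyFibre (R : MvPolynomial (Fin 2) ℂ)
    (hR : ∃ x y : ℂ, (y - x) ^ 2 - I * x = 0 ∧ MvPolynomial.eval ![x, y] R ≠ 0) :
    MMCaseDimPiOneFree {w : Fin 2 ⊕ Fin 2 → ℂ |
        (w (Sum.inl 1) - w (Sum.inl 0)) ^ 2 - I * w (Sum.inl 0) = 0 ∧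
        w (Sum.inr 0) = MvPolynomial.eval ![w (Sum.inl 0), w (Sum.inl 1)] R} ∧
      UnprojectedDense {w : Fin 2 ⊕ Fin 2 → ℂ |
        (w (Sum.inl 1) - w (Sum.inl 0)) ^ 2 - I * w (Sum.inl 0) = 0 ∧
        w (Sum.inr 0) = MvPolynomial.eval ![w (Sum.inl 0), w (Sum.inl 1)] R} := by
  classical
  set F : ℂ[X][X] := (X - Polynomial.C (X : ℂ[X])) ^ 2 - Polynomial.C (Polynomial.C I * X : ℂ[X])
    with hF
  have hset : {w : Fin 2 ⊕ Fin 2 → ℂ |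
      (w (Sum.inl 1) - w (Sum.inl 0)) ^ 2 - I * w (Sum.inl 0) = 0 ∧
      w (Sum.inr 0) = MvPolynomial.eval ![w (Sum.inl 0), w (Sum.inl 1)] R} =
      {w : Fin 2 ⊕ Fin 2 → ℂ |
        (F.map (Polynomial.evalRingHom (w (Sum.inl 0)))).eval (w (Sum.inl 1)) = 0 ∧
        w (Sum.inr 0) = MvPolynomial.eval ![w (Sum.inl 0), w (Sum.inl 1)] R} := by
    ext w; simp only [Set.mem_setOf_eq, hF, shearedParabolaI_eval]
  rw [hset]
  -- a square root `c` of `i`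
  obtain ⟨c, hc⟩ := IsAlgClosed.exists_pow_nat_eq (I : ℂ) two_pos
  set U : Matrix (Fin 2) (Fin 2) ℤ := !![1, 0; -1, 1] with hU
  set V : Matrix (Fin 2) (Fin 2) ℤ := !![1, 0; 1, 1] with hV
  have hUV : U * V = 1 := by rw [hU, hV]; decide
  have hVU : V * U = 1 := by rw [hU, hV]; decide
  set X₁ : ℂ → ℂ := fun s => (s ^ 2)⁻¹ + c * (s ^ 1)⁻¹ with hX₁
  have hX₁Φ : ∀ᶠ s in 𝓝[≠] (0 : ℂ), X₁ s = (fun s : ℂ => 1 + c * s) s * (s ^ 2)⁻¹ := by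
    filter_upwards [self_mem_nhdsWithin] with s (hs0 : s ≠ 0)
    simp only [hX₁, pow_one]
    field_simp
  have hγ : ∀ᶠ s in 𝓝[≠] (0 : ℂ), (U 1 0 : ℂ) * (s ^ 2)⁻¹ + (U 1 1 : ℂ) * X₁ s =
      (fun _ : ℂ => c) s * (s ^ 1)⁻¹ := by
    filter_upwards [self_mem_nhdsWithin] with s (hs0 : s ≠ 0)
    simp [hU, hX₁]
  have hplace : ∀ᶠ s in 𝓝[≠] (0 : ℂ), (F.map (Polynomial.evalRingHom (s ^ 2)⁻¹)).eval (X₁ s) = 0 := by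
    filter_upwards [self_mem_nhdsWithin] with s (hs0 : s ≠ 0)
    rw [hF, shearedParabolaI_eval, hX₁]
    simp only [pow_one]
    have e : ((s ^ 2)⁻¹ + c * s⁻¹ - (s ^ 2)⁻¹) ^ 2 = c ^ 2 * (s ^ 2)⁻¹ := by ring
    rw [e, hc]
    ring
  -- the direction: `(cz)² = i·2πi = −2π`
  obtain ⟨z, hz⟩ := IsAlgClosed.exists_pow_nat_eq (2 * Real.pi * I : ℂ) two_pos
  have hw : (c * z ^ 1) ^ 2 = -(2 * Real.pi : ℝ) := by
    rw [pow_one, mul_pow, hc, hz]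
    push_cast
    have : I * (2 * Real.pi * I) = 2 * Real.pi * I ^ 2 := by ring
    rw [this, Complex.I_sq]
    ring
  have hdir : ∃ z : ℂ, z ^ 2 = 2 * Real.pi * I ∧ (((fun _ : ℂ => c) 0 * z ^ 1).re ≠ 0 ∨
      Irrational (((fun _ : ℂ => c) 0 * z ^ 1).im / (2 * Real.pi))) :=
    ⟨z, hz, Or.inr (irrational_im_div_of_sq_eq_neg_two_pi hw)⟩
  refine unprojectedDensityQuestion_planeCurve_polyFibre_transportedSlow F shearedParabolaI_irreducible
    (by rw [shearedParabolaI_natDegree]) U V hUV hVU le_rfl one_lt_two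
    (analyticAt_const.add (analyticAt_const.mul analyticAt_id)) analyticAt_const hX₁Φ
    (by simp [hU]) hγ hdir hplace R ?_
  obtain ⟨x, y, hxy, hne⟩ := hR
  exact ⟨x, y, by rw [hF, shearedParabolaI_eval]; exact hxy, hne⟩

end ShearedParabolaI

end Summit.Schanuel.Schanuel.Theorems

end
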